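import Literature.Probability.Percolation.QuadCrossingRotationInvarianceOfSS
import Literature.Probability.Percolation.PlateChartRoom

/-!
# Stub `stub_dilationEquicontinuity` of the birth skeleton of the crux `PolyominoGaussianLaw`
# (stmt-CriticalPhenomena-14337, route `CardyTensorRG`) — Part 2: framed domains and their quads

A conformal rectangle is read through a square model `Ψ : ℂ ≃ₜ ℂ` (Schoenflies,
`exists_isSquareModel`): carrier `Ψ((-1,1)²)`, arcs `0`/`2` = `Ψ`(bottom/top side). This part
records the plane-topology bookkeeping of such *framed domains* and of the parametrised quads
`squareModelQuad (sc ∘ Ψ)` of Schramm–Smirnov's space `𝒬_ℂ` obtained by precomposing with an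
anisotropic scaling `sc(x + iy) = αx + iβy` of the model square (the inner/outer comparison quads
of the sandwich):

* closure / frontier of `Ψ((-1,1)²)` (`dl_closure_framed`, `dl_frontier_framed`,
  `dl_mem_frontier_openSq`);
* existence of the scaling homeomorphism (`dl_exists_scaleHomeomorph`) and the images of the
  closed square and of its bottom/top sides under it;
* carrier and sides `0`, `2` of `squareModelQuad Θ` for an arbitrary `Θ : ℂ ≃ₜ ℂ`
  (`dl_carrier_squareModelQuad`, `dl_side_zero_squareModelQuad`, `dl_side_two_squareModelQuad`;
  the tree's versions assume `Θ` is a square model of a given rectangle);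
* the uniform distance in `𝒬_ℂ` between the quad of `t Ψ sc` and the quad of `Ψ`
  (`dl_dist_squareModelQuad_le`).

All [folklore].
-/

noncomputable section

open Set Metric Complex
open scoped unitInterval
open Literature.Probability.LatticeModels Literature.Probability.Percolation
open Literature.Probability.Percolation.QuadCrossing

namespace Summit.CriticalPhenomena.CardyFormulaZ2.Cruxes.PolyominoGaussianLaw.Birth

/-! ### The model square -/

/-- The frontier of the open model square `(-1,1)²`: the four closed sides. [folklore] -/
theorem dl_mem_frontier_openSq {p : ℂ} :
    p ∈ frontier (Ioo (-1 : ℝ) 1 ×ℂ Ioo (-1 : ℝ) 1) ↔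
      ((-1 ≤ p.re ∧ p.re ≤ 1) ∧ (p.im = -1 ∨ p.im = 1)) ∨
        ((p.re = -1 ∨ p.re = 1) ∧ (-1 ≤ p.im ∧ p.im ≤ 1)) := by
  rw [← unitSquareQuad_carrier]
  exact mem_frontier_unitSquareQuad

/-- The closure of the open model square is the closed model square. [folklore] -/
theorem dl_closure_openSq :
    closure (Ioo (-1 : ℝ) 1 ×ℂ Ioo (-1 : ℝ) 1) = Icc (-1 : ℝ) 1 ×ℂ Icc (-1 : ℝ) 1 := by
  rw [Complex.closure_reProdIm, closure_Ioo (by norm_num)]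

/-- The open model square is open. [folklore] -/
theorem dl_isOpen_openSq : IsOpen (Ioo (-1 : ℝ) 1 ×ℂ Ioo (-1 : ℝ) 1) :=
  isOpen_Ioo.reProdIm isOpen_Ioo

/-- The closed model square is compact. [folklore] -/
theorem dl_isCompact_Sq : IsCompact (Icc (-1 : ℝ) 1 ×ℂ Icc (-1 : ℝ) 1) :=
  isCompact_Icc.reProdIm isCompact_Icc

/-! ### Framed domains `Ψ((-1,1)²)` -/

/-- The closure of a framed domain is the image of the closed square. [folklore] -/
theorem dl_closure_framed (Ψ : ℂ ≃ₜ ℂ) :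
    closure (Ψ '' (Ioo (-1 : ℝ) 1 ×ℂ Ioo (-1 : ℝ) 1)) = Ψ '' (Icc (-1 : ℝ) 1 ×ℂ Icc (-1 : ℝ) 1) := by
  rw [← Ψ.image_closure, dl_closure_openSq]

/-- The frontier of a framed domain is the image of the four sides. [folklore] -/
theorem dl_frontier_framed (Ψ : ℂ ≃ₜ ℂ) :
    frontier (Ψ '' (Ioo (-1 : ℝ) 1 ×ℂ Ioo (-1 : ℝ) 1)) =
      Ψ '' frontier (Ioo (-1 : ℝ) 1 ×ℂ Ioo (-1 : ℝ) 1) :=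
  (Ψ.image_frontier _).symm

/-- A framed domain is open. [folklore] -/
theorem dl_isOpen_framed (Ψ : ℂ ≃ₜ ℂ) : IsOpen (Ψ '' (Ioo (-1 : ℝ) 1 ×ℂ Ioo (-1 : ℝ) 1)) :=
  Ψ.isOpenMap _ dl_isOpen_openSq

/-- A framed domain lies in the image of the closed square. [folklore] -/
theorem dl_framed_subset_image_Sq (Ψ : ℂ ≃ₜ ℂ) :
    Ψ '' (Ioo (-1 : ℝ) 1 ×ℂ Ioo (-1 : ℝ) 1) ⊆ Ψ '' (Icc (-1 : ℝ) 1 ×ℂ Icc (-1 : ℝ) 1) :=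
  image_mono fun _ hp => ⟨Ioo_subset_Icc_self hp.1, Ioo_subset_Icc_self hp.2⟩

/-- The model point of a point of `Ψ '' S` lies in `S`. [folklore] -/
theorem dl_symm_mem_of_mem_image (Ψ : ℂ ≃ₜ ℂ) {S : Set ℂ} {z : ℂ} (hz : z ∈ Ψ '' S) :
    Ψ.symm z ∈ S := by
  obtain ⟨p, hp, rfl⟩ := hz
  rwa [Ψ.symm_apply_apply]

/-- The bottom side lies in the closed square. [folklore] -/
theorem dl_bot_subset_Sq :
    {p : ℂ | p.im = -1 ∧ p.re ∈ Icc (-1 : ℝ) 1} ⊆ Icc (-1 : ℝ) 1 ×ℂ Icc (-1 : ℝ) 1 :=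
  fun p hp => ⟨hp.2, by rw [mem_preimage, hp.1]; exact ⟨by norm_num, by norm_num⟩⟩

/-- The top side lies in the closed square. [folklore] -/
theorem dl_top_subset_Sq :
    {p : ℂ | p.im = 1 ∧ p.re ∈ Icc (-1 : ℝ) 1} ⊆ Icc (-1 : ℝ) 1 ×ℂ Icc (-1 : ℝ) 1 :=
  fun p hp => ⟨hp.2, by rw [mem_preimage, hp.1]; exact ⟨by norm_num, by norm_num⟩⟩

/-- The bottom side lies in the frontier of the open square. [folklore] -/
theorem dl_bot_subset_frontier :
    {p : ℂ | p.im = -1 ∧ p.re ∈ Icc (-1 : ℝ) 1} ⊆ frontier (Ioo (-1 : ℝ) 1 ×ℂ Ioo (-1 : ℝ) 1) :=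
  fun _ hp => dl_mem_frontier_openSq.2 (Or.inl ⟨hp.2, Or.inl hp.1⟩)

/-- The top side lies in the frontier of the open square. [folklore] -/
theorem dl_top_subset_frontier :
    {p : ℂ | p.im = 1 ∧ p.re ∈ Icc (-1 : ℝ) 1} ⊆ frontier (Ioo (-1 : ℝ) 1 ×ℂ Ioo (-1 : ℝ) 1) :=
  fun _ hp => dl_mem_frontier_openSq.2 (Or.inl ⟨hp.2, Or.inr hp.1⟩)

/-! ### Anisotropic scalings of the model square -/

/-- **The anisotropic scaling `x + iy ↦ αx + iβy`** (`α, β > 0`) is a homeomorphism of the plane.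
[folklore] -/
theorem dl_exists_scaleHomeomorph {α β : ℝ} (hα : 0 < α) (hβ : 0 < β) :
    ∃ sc : ℂ ≃ₜ ℂ, ∀ z, sc z = ⟨α * z.re, β * z.im⟩ := by
  have hc : ∀ a b : ℝ, Continuous fun z : ℂ => (⟨a * z.re, b * z.im⟩ : ℂ) := fun a b => by
    refine Continuous.comp (f := fun z : ℂ => (a * z.re, b * z.im))
      (g := fun p : ℝ × ℝ => (⟨p.1, p.2⟩ : ℂ)) ?_ (by fun_prop)
    exact Complex.equivRealProdCLM.symm.continuous
  refine ⟨{ toFun := fun z => ⟨α * z.re, β * z.im⟩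
            invFun := fun z => ⟨α⁻¹ * z.re, β⁻¹ * z.im⟩
            left_inv := fun z => ?_
            right_inv := fun z => ?_
            continuous_toFun := hc α β
            continuous_invFun := hc α⁻¹ β⁻¹ }, fun z => rfl⟩
  · apply Complex.ext
    · show α⁻¹ * (α * z.re) = z.re
      rw [← mul_assoc, inv_mul_cancel₀ hα.ne', one_mul]
    · show β⁻¹ * (β * z.im) = z.im
      rw [← mul_assoc, inv_mul_cancel₀ hβ.ne', one_mul]
  · apply Complex.ext
    · show α * (α⁻¹ * z.re) = z.re
      rw [← mul_assoc, mul_inv_cancel₀ hα.ne', one_mul]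
    · show β * (β⁻¹ * z.im) = z.im
      rw [← mul_assoc, mul_inv_cancel₀ hβ.ne', one_mul]

section Scale

variable {sc : ℂ ≃ₜ ℂ} {α β : ℝ}

/-- The scaling maps the closed square onto `[-α, α] × [-β, β]`. [folklore] -/
theorem dl_image_scale_Sq (hsc : ∀ z, sc z = ⟨α * z.re, β * z.im⟩) (hα : 0 < α) (hβ : 0 < β) :
    sc '' (Icc (-1 : ℝ) 1 ×ℂ Icc (-1 : ℝ) 1) = Icc (-α) α ×ℂ Icc (-β) β := by
  ext w
  constructor
  · rintro ⟨z, ⟨⟨h1, h2⟩, ⟨h3, h4⟩⟩, rfl⟩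
    rw [hsc]
    exact ⟨⟨by show -α ≤ α * z.re; nlinarith, by show α * z.re ≤ α; nlinarith⟩,
      ⟨by show -β ≤ β * z.im; nlinarith, by show β * z.im ≤ β; nlinarith⟩⟩
  · rintro ⟨⟨h1, h2⟩, ⟨h3, h4⟩⟩
    refine ⟨⟨w.re / α, w.im / β⟩, ⟨⟨?_, ?_⟩, ⟨?_, ?_⟩⟩, ?_⟩
    · show -1 ≤ w.re / α
      rw [le_div_iff₀ hα]; linarith
    · show w.re / α ≤ 1
      rw [div_le_iff₀ hα]; linarith
    · show -1 ≤ w.im / β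
      rw [le_div_iff₀ hβ]; linarith
    · show w.im / β ≤ 1
      rw [div_le_iff₀ hβ]; linarith
    · rw [hsc]; apply Complex.ext
      · show α * (w.re / α) = w.re
        field_simp
      · show β * (w.im / β) = w.im
        field_simp

/-- The scaling maps the bottom side onto the bottom side of `[-α, α] × [-β, β]`. [folklore] -/
theorem dl_image_scale_bot (hsc : ∀ z, sc z = ⟨α * z.re, β * z.im⟩) (hα : 0 < α) :
    sc '' {p : ℂ | p.im = -1 ∧ p.re ∈ Icc (-1 : ℝ) 1} = {p : ℂ | p.im = -β ∧ p.re ∈ Icc (-α) α} := by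
  ext w
  constructor
  · rintro ⟨z, ⟨h1, h2, h3⟩, rfl⟩
    rw [hsc]
    refine ⟨by show β * z.im = -β; rw [h1]; ring, ?_, ?_⟩
    · show -α ≤ α * z.re; nlinarith
    · show α * z.re ≤ α; nlinarith
  · rintro ⟨h1, h2, h3⟩
    refine ⟨⟨w.re / α, -1⟩, ⟨rfl, ?_, ?_⟩, ?_⟩
    · show -1 ≤ w.re / α
      rw [le_div_iff₀ hα]; linarith
    · show w.re / α ≤ 1
      rw [div_le_iff₀ hα]; linarith
    · rw [hsc]; apply Complex.ext
      · show α * (w.re / α) = w.re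
        field_simp
      · show β * (-1) = w.im
        rw [h1]; ring

/-- The scaling maps the top side onto the top side of `[-α, α] × [-β, β]`. [folklore] -/
theorem dl_image_scale_top (hsc : ∀ z, sc z = ⟨α * z.re, β * z.im⟩) (hα : 0 < α) :
    sc '' {p : ℂ | p.im = 1 ∧ p.re ∈ Icc (-1 : ℝ) 1} = {p : ℂ | p.im = β ∧ p.re ∈ Icc (-α) α} := by
  ext w
  constructor
  · rintro ⟨z, ⟨h1, h2, h3⟩, rfl⟩
    rw [hsc]
    refine ⟨by show β * z.im = β; rw [h1]; ring, ?_, ?_⟩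
    · show -α ≤ α * z.re; nlinarith
    · show α * z.re ≤ α; nlinarith
  · rintro ⟨h1, h2, h3⟩
    refine ⟨⟨w.re / α, 1⟩, ⟨rfl, ?_, ?_⟩, ?_⟩
    · show -1 ≤ w.re / α
      rw [le_div_iff₀ hα]; linarith
    · show w.re / α ≤ 1
      rw [div_le_iff₀ hα]; linarith
    · rw [hsc]; apply Complex.ext
      · show α * (w.re / α) = w.re
        field_simp
      · show β * 1 = w.im
        rw [h1]; ring

/-- The scaling moves points of the closed square by at most `|α - 1| + |β - 1|`. [folklore] -/
theorem dl_dist_scale_le (hsc : ∀ z, sc z = ⟨α * z.re, β * z.im⟩) {c : ℂ}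
    (hc : c ∈ Icc (-1 : ℝ) 1 ×ℂ Icc (-1 : ℝ) 1) : dist (sc c) c ≤ |α - 1| + |β - 1| := by
  obtain ⟨⟨h1, h2⟩, ⟨h3, h4⟩⟩ := hc
  rw [dist_eq_norm, hsc]
  refine (norm_le_abs_re_add_abs_im _).trans ?_
  have hre : ((⟨α * c.re, β * c.im⟩ : ℂ) - c).re = (α - 1) * c.re := by
    simp only [Complex.sub_re]; ring
  have him : ((⟨α * c.re, β * c.im⟩ : ℂ) - c).im = (β - 1) * c.im := by
    simp only [Complex.sub_im]; ring
  rw [hre, him, abs_mul, abs_mul]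
  have hcre : |c.re| ≤ 1 := abs_le.2 ⟨h1, h2⟩
  have hcim : |c.im| ≤ 1 := abs_le.2 ⟨h3, h4⟩
  nlinarith [abs_nonneg (α - 1), abs_nonneg (β - 1), abs_nonneg c.re, abs_nonneg c.im]

end Scale

/-! ### The quads `squareModelQuad Θ` of Schramm–Smirnov's space -/

/-- The carrier of the quad of `Θ` is the image of the closed square. [folklore] -/
theorem dl_carrier_squareModelQuad (Θ : ℂ ≃ₜ ℂ) :
    (squareModelQuad Θ).carrier = Θ '' (Icc (-1 : ℝ) 1 ×ℂ Icc (-1 : ℝ) 1) := by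
  rw [Quad.carrier, show ((squareModelQuad Θ : Quad (univ : Set ℂ)) : I × I → ℂ) =
    Θ ∘ unitSquareChart from rfl, range_comp, range_unitSquareChart]

/-- Side `0` of the quad of `Θ` is the image of the bottom side. [folklore] -/
theorem dl_side_zero_squareModelQuad (Θ : ℂ ≃ₜ ℂ) :
    (squareModelQuad Θ).side 0 = Θ '' {p : ℂ | p.im = -1 ∧ p.re ∈ Icc (-1 : ℝ) 1} := by
  change (fun z => Θ (unitSquareChart z)) '' {z : I × I | z.1 = 0} = _
  rw [← image_image (g := Θ) (f := unitSquareChart)]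
  congr 1
  ext w
  rw [mem_image]
  constructor
  · rintro ⟨⟨s, t⟩, hs, rfl⟩
    have hs0 : (s : ℝ) = 0 := by exact_mod_cast congrArg Subtype.val hs
    have ht := t.2
    simp only [mem_Icc] at ht
    simp only [unitSquareChart, mem_Icc, hs0, mem_setOf_eq]
    exact ⟨by ring, by linarith, by linarith⟩
  · rintro ⟨hw, h1, h2⟩
    refine ⟨(0, ⟨(1 - w.re) / 2, ⟨by linarith, by linarith⟩⟩), rfl, ?_⟩
    apply Complex.ext <;> simp only [unitSquareChart, Set.Icc.coe_zero] <;> [ring; (rw [hw]; ring)]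

/-- Side `2` of the quad of `Θ` is the image of the top side. [folklore] -/
theorem dl_side_two_squareModelQuad (Θ : ℂ ≃ₜ ℂ) :
    (squareModelQuad Θ).side 2 = Θ '' {p : ℂ | p.im = 1 ∧ p.re ∈ Icc (-1 : ℝ) 1} := by
  change (fun z => Θ (unitSquareChart z)) '' {z : I × I | z.1 = 1} = _
  rw [← image_image (g := Θ) (f := unitSquareChart)]
  congr 1
  ext w
  rw [mem_image]
  constructor
  · rintro ⟨⟨s, t⟩, hs, rfl⟩
    have hs1 : (s : ℝ) = 1 := by exact_mod_cast congrArg Subtype.val hs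
    have ht := t.2
    simp only [mem_Icc] at ht
    simp only [unitSquareChart, mem_Icc, hs1, mem_setOf_eq]
    exact ⟨by ring, by linarith, by linarith⟩
  · rintro ⟨hw, h1, h2⟩
    refine ⟨(1, ⟨(1 - w.re) / 2, ⟨by linarith, by linarith⟩⟩), rfl, ?_⟩
    apply Complex.ext <;> simp only [unitSquareChart, Set.Icc.coe_one] <;> [ring; (rw [hw]; ring)]

/-- The carrier of the quad of `sc ∘ Ψ` for a scaling `sc`. [folklore] -/
theorem dl_carrier_squareModelQuad_scale {sc : ℂ ≃ₜ ℂ} {α β : ℝ}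
    (hsc : ∀ z, sc z = ⟨α * z.re, β * z.im⟩) (hα : 0 < α) (hβ : 0 < β) (Ψ : ℂ ≃ₜ ℂ) :
    (squareModelQuad (sc.trans Ψ)).carrier = Ψ '' (Icc (-α) α ×ℂ Icc (-β) β) := by
  rw [dl_carrier_squareModelQuad, show (⇑(sc.trans Ψ) : ℂ → ℂ) = Ψ ∘ sc from rfl, image_comp,
    dl_image_scale_Sq hsc hα hβ]

/-- Side `0` of the quad of `sc ∘ Ψ` for a scaling `sc`. [folklore] -/
theorem dl_side_zero_squareModelQuad_scale {sc : ℂ ≃ₜ ℂ} {α β : ℝ}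
    (hsc : ∀ z, sc z = ⟨α * z.re, β * z.im⟩) (hα : 0 < α) (Ψ : ℂ ≃ₜ ℂ) :
    (squareModelQuad (sc.trans Ψ)).side 0 = Ψ '' {p : ℂ | p.im = -β ∧ p.re ∈ Icc (-α) α} := by
  rw [dl_side_zero_squareModelQuad, show (⇑(sc.trans Ψ) : ℂ → ℂ) = Ψ ∘ sc from rfl, image_comp,
    dl_image_scale_bot hsc hα]

/-- Side `2` of the quad of `sc ∘ Ψ` for a scaling `sc`. [folklore] -/
theorem dl_side_two_squareModelQuad_scale {sc : ℂ ≃ₜ ℂ} {α β : ℝ}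
    (hsc : ∀ z, sc z = ⟨α * z.re, β * z.im⟩) (hα : 0 < α) (Ψ : ℂ ≃ₜ ℂ) :
    (squareModelQuad (sc.trans Ψ)).side 2 = Ψ '' {p : ℂ | p.im = β ∧ p.re ∈ Icc (-α) α} := by
  rw [dl_side_two_squareModelQuad, show (⇑(sc.trans Ψ) : ℂ → ℂ) = Ψ ∘ sc from rfl, image_comp,
    dl_image_scale_top hsc hα]

/-- **The quad of the scaled and dilated frame is uniformly close to the quad of the frame.**
If `sc` moves the points of the closed square by less than the `r/4`-modulus of continuity `η` of
`Φ` on the square, `‖Φ‖ ≤ M` on the square and `(1 - t) M ≤ r / 4` (`0 < t ≤ 1`), then the quad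
of `z ↦ t Φ(sc z)` is within `r / 2` of the quad of `Φ` in the uniform metric of `𝒬_ℂ`.
[folklore] -/
theorem dl_dist_squareModelQuad_le (Φ sc : ℂ ≃ₜ ℂ) {α β t r M η : ℝ}
    (hsc : ∀ z, sc z = ⟨α * z.re, β * z.im⟩) (hα : 0 < α) (hα1 : α ≤ 1) (hβ : 0 < β) (hβ1 : β ≤ 1)
    (hr : 0 ≤ r) (ht1 : t ≤ 1)
    (hM : ∀ z ∈ Icc (-1 : ℝ) 1 ×ℂ Icc (-1 : ℝ) 1, ‖Φ z‖ ≤ M) (htM : (1 - t) * M ≤ r / 4)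
    (hη : ∀ z ∈ Icc (-1 : ℝ) 1 ×ℂ Icc (-1 : ℝ) 1, ∀ z' ∈ Icc (-1 : ℝ) 1 ×ℂ Icc (-1 : ℝ) 1,
      dist z z' < η → dist (Φ z) (Φ z') < r / 4)
    (hw : |α - 1| + |β - 1| < η) (ht' : (t : ℂ) ≠ 0) :
    dist (squareModelQuad (sc.trans (Φ.trans (Homeomorph.mulLeft₀ (t : ℂ) ht'))))
      (squareModelQuad Φ) ≤ r / 2 := by
  rw [Quad.dist_eq, ContinuousMap.dist_le (by positivity)]
  intro z
  simp only [Quad.toContinuousMap_apply, squareModelQuad_apply, Homeomorph.trans_apply,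
    Homeomorph.coe_mulLeft₀]
  set c : ℂ := unitSquareChart z with hc
  have hcS : c ∈ Icc (-1 : ℝ) 1 ×ℂ Icc (-1 : ℝ) 1 := by
    rw [← range_unitSquareChart]; exact mem_range_self z
  have hscc : sc c ∈ Icc (-1 : ℝ) 1 ×ℂ Icc (-1 : ℝ) 1 := by
    have : sc c ∈ sc '' (Icc (-1 : ℝ) 1 ×ℂ Icc (-1 : ℝ) 1) := mem_image_of_mem _ hcS
    rw [dl_image_scale_Sq hsc hα hβ] at this
    exact ⟨⟨by linarith [this.1.1], by linarith [this.1.2]⟩,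
      ⟨by linarith [this.2.1], by linarith [this.2.2]⟩⟩
  have h1 : dist ((t : ℂ) * Φ (sc c)) (Φ (sc c)) ≤ r / 4 := by
    rw [dist_eq_norm, show (t : ℂ) * Φ (sc c) - Φ (sc c) = ((t - 1 : ℝ) : ℂ) * Φ (sc c) by
      push_cast; ring, norm_mul, Complex.norm_real, Real.norm_eq_abs, abs_sub_comm,
      abs_of_nonneg (by linarith)]
    calc (1 - t) * ‖Φ (sc c)‖ ≤ (1 - t) * M :=
          mul_le_mul_of_nonneg_left (hM _ hscc) (by linarith)
      _ ≤ r / 4 := htM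
  have h2 : dist (Φ (sc c)) (Φ c) < r / 4 :=
    hη _ hscc _ hcS ((dl_dist_scale_le hsc hcS).trans_lt hw)
  calc dist ((t : ℂ) * Φ (sc c)) (Φ c)
      ≤ dist ((t : ℂ) * Φ (sc c)) (Φ (sc c)) + dist (Φ (sc c)) (Φ c) := dist_triangle _ _ _
    _ ≤ r / 4 + r / 4 := add_le_add h1 h2.le
    _ = r / 2 := by ring

/-! ### Registered one-line form -/

/-- **Registered sub-goal `stub_dilationEquicontinuity_part2`** of `stub_dilationEquicontinuity`
(stmt-CriticalPhenomena-14337): the carrier of the quad of a plane homeomorphism, one-line form of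
`dl_carrier_squareModelQuad`. [folklore] -/
theorem stub_dilationEquicontinuity_part2 : ∀ Θ : ℂ ≃ₜ ℂ, (Literature.Probability.Percolation.squareModelQuad Θ).carrier = Θ '' (Set.Icc (-1 : ℝ) 1 ×ℂ Set.Icc (-1 : ℝ) 1) :=
  dl_carrier_squareModelQuad

end Summit.CriticalPhenomena.CardyFormulaZ2.Cruxes.PolyominoGaussianLaw.Birth
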